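import Summits.HodgeConjecture.HodgeConjecture.Theses.PadicSemiregularLift
import Literature.AlgebraicGeometry.Morphisms.DevissageHeart
import Literature.AlgebraicGeometry.Morphisms.Devissage
import Literature.AlgebraicGeometry.Morphisms.CechModuleExactH0
import Literature.AlgebraicGeometry.Morphisms.CechModuleShortExact
import Literature.AlgebraicGeometry.Morphisms.CechModuleUnit
import Literature.AlgebraicGeometry.Morphisms.FormalFunctionsTorsionML
import Literature.AlgebraicGeometry.Modules.LinearOverBase
import Literature.AlgebraicGeometry.Modules.AffineLocalizingClosure
import Literature.AlgebraicGeometry.Modules.FiniteType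
import Literature.AlgebraicGeometry.Modules.LocalFrames
import Literature.AlgebraicGeometry.Modules.IdealSheafNoetherian

/-!
# One-level `H⁰` formal functions for a vector bundle (module Bockstein lemma)

Stub EC (`stub_moduleBockstein`) of line `chow-zariski-pushforward` of the crux
`PadicSemiregularLift.FormalVectorBundlesAlgebraize` (stmt-HodgeConjecture-14106): for `A` Noetherian,
`f : X → Spec A` proper, `a ∈ A` and a vector bundle `M` on `X` on which `a` acts injectively, there is
`c` such that for every `n` every global section of `M / a^{n+1+c} M` reduces modulo `a^{n+1}` to the
class of a GLOBAL section of `M` (The Stacks Project, Tag 02OB (3); EGA III₁ 4.1.5). Proof (the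
connecting-homomorphism argument of `Morphisms/FormalFunctionsCechProofs`, for modules):

* `coh_of_isVectorBundle` — a vector bundle is coherent in the affine-local sense `Coh` of the
  dévissage: quasi-coherent ⇒ affine-localizing; it is FINITE locally free (Stacks 01C6, by the rank
  lemma `finite_of_epi_free_over`, adapted from `Theorems/FormalLiftingFromClassLifting/Negative/
  VectorBundleConverse.lean`, whose module could not be imported: not built on the farm), so on a basic
  open `D(g)` of an affine `V` inside a trivialising open every section is a combination of finitely
  many basis sections (`eq_sum_coord_smul`), and finite generation of `Γ(V, M)` follows by numerators,
  torsion and descent along a finite basic open cover (`isAffineFiniteType_of_isVectorBundle`);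
* hence `H = Ȟ¹(𝒰, M)` on a finite affine open cover `𝒰` is a finite `A`-module (`devissage`,
  `heart_holds`), whose `a`-power torsion is killed by a fixed `a^c` (`exists_torsionBy_pow_stable`);
* for `N = n + 1 + c` the sequences `0 → M —a^N→ M → M/a^N → 0`, `0 → M —a^{n+1}→ M → M/a^{n+1} → 0`
  give connecting maps `δ_N`, `δ_{n+1}` to `H` (`CechExactData.of_shortExact`, `cechDelta`) with
  `a^N δ_N(t) = 0` and, along the morphism of sequences `(a^c, 𝟙, r)`, `δ_{n+1}(r t) = a^c δ_N(t) = 0`;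
  so `r t` lifts to `Ȟ⁰(𝒰, M) = Γ(X, M)` (`exists_cechMapH0_eq_of_cechDelta_eq_zero`).
-/

noncomputable section

-- Summit.HodgeConjecture.HodgeConjecture.… repeats the summit name by the D-0017 layout (Sub = Summit).
set_option linter.dupNamespace false

open CategoryTheory CategoryTheory.Limits AlgebraicGeometry TopologicalSpace Opposite
open Literature.AlgebraicGeometry.Motives
open Literature.AlgebraicGeometry.Morphisms
open Literature.AlgebraicGeometry.Modules

namespace Summit.HodgeConjecture.HodgeConjecture.Theorems.FormalVectorBundlesAlgebraize

universe u

/-! ## Vector bundles are coherent (`Coh`) -/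

section Coh

variable {X : Scheme.{u}}

/-- **An epimorphism `𝒪^K ↠ 𝒪^I` of free modules on the opens over a non-empty open `W` of a scheme,
with `K` finite, forces `I` finite**: `End(𝒪)` is a non-zero commutative ring there, and `Hom(-, 𝒪)`
turns the epimorphism into an injective `End(𝒪)`-linear map `End(𝒪)^(I) → End(𝒪)^K`, so that `I` is
finite by the strong rank condition (Mathlib `LinearIndependent.finite_of_le_span_finite`). Adapted from
`finite_of_epi_free` of `Theorems/FormalLiftingFromClassLifting/Negative/VectorBundleConverse.lean`. -/
theorem finite_of_epi_free_over (W : X.Opens) [Nonempty W] {I K : Type u} [Finite K]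
    (π : SheafOfModules.free (R := X.ringCatSheaf.over W) K ⟶
      SheafOfModules.free (R := X.ringCatSheaf.over W) I) [Epi π] : Finite I := by
  classical
  -- `End(𝒪)` is a non-zero commutative ring
  have hcomm : ∀ a b : End (SheafOfModules.unit (X.ringCatSheaf.over W)), a * b = b * a := by
    intro a b
    change b ≫ a = a ≫ b
    refine SheafOfModules.hom_ext (PresheafOfModules.hom_ext fun Y => ModuleCat.hom_ext
      (LinearMap.ext fun y => ?_))
    let f : (X.ringCatSheaf.over W).obj.obj Y →ₗ[(X.ringCatSheaf.over W).obj.obj Y]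
        (X.ringCatSheaf.over W).obj.obj Y := (a.val.app Y).hom
    let g : (X.ringCatSheaf.over W).obj.obj Y →ₗ[(X.ringCatSheaf.over W).obj.obj Y]
        (X.ringCatSheaf.over W).obj.obj Y := (b.val.app Y).hom
    obtain ⟨z, rfl⟩ : ∃ z : (X.ringCatSheaf.over W).obj.obj Y, z = y := ⟨y, rfl⟩
    change f (g z) = g (f z)
    have hf : ∀ t, f t = t * f 1 := fun t => by
      have h := f.map_smul t 1
      rwa [smul_eq_mul, mul_one, smul_eq_mul] at h
    have hg : ∀ t, g t = t * g 1 := fun t => by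
      have h := g.map_smul t 1
      rwa [smul_eq_mul, mul_one, smul_eq_mul] at h
    rw [hg z, hf (z * _), hf z, hg (z * _)]
    have key : ∀ r s t : Γ(X, Y.unop.left), r * s * t = r * t * s := fun r s t => mul_right_comm r s t
    exact key _ _ _
  have hnt : (𝟙 (SheafOfModules.unit (X.ringCatSheaf.over W)) :
      End (SheafOfModules.unit (X.ringCatSheaf.over W))) ≠ 0 := by
    intro h0
    have key := congrArg (fun u : SheafOfModules.unit (X.ringCatSheaf.over W) ⟶
        SheafOfModules.unit (X.ringCatSheaf.over W) =>
          ((u.val.app (op (Over.mk (𝟙 W)))).hom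
            (1 : (X.ringCatSheaf.over W).obj.obj (op (Over.mk (𝟙 W)))) :
            (X.ringCatSheaf.over W).obj.obj (op (Over.mk (𝟙 W))))) h0
    change (1 : Γ(X, W)) = 0 at key
    exact one_ne_zero key
  letI : CommRing (End (SheafOfModules.unit (X.ringCatSheaf.over W))) :=
    { (inferInstance : Ring (End (SheafOfModules.unit (X.ringCatSheaf.over W)))) with
      mul_comm := hcomm }
  haveI : Nontrivial (End (SheafOfModules.unit (X.ringCatSheaf.over W))) := ⟨⟨_, _, hnt⟩⟩
  have free_hom_ext : ∀ {I' : Type u} {Z : SheafOfModules.{u} (X.ringCatSheaf.over W)}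
      (f g : SheafOfModules.free I' ⟶ Z),
      (∀ i, SheafOfModules.ιFree i ≫ f = SheafOfModules.ιFree i ≫ g) → f = g :=
    fun f g h => Cofan.IsColimit.hom_ext (SheafOfModules.isColimitFreeCofan _) _ _ fun i => h i
  -- the morphism `free I ⟶ 𝒪` with finitely supported coordinates `c`
  let D : (I →₀ End (SheafOfModules.unit (X.ringCatSheaf.over W))) →
      (SheafOfModules.free (R := X.ringCatSheaf.over W) I ⟶
        SheafOfModules.unit (X.ringCatSheaf.over W)) :=
    fun c => Cofan.IsColimit.desc (SheafOfModules.isColimitFreeCofan I) fun i => End.asHom (c i)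
  have hD : ∀ c i, SheafOfModules.ιFree i ≫ D c = End.asHom (c i) :=
    fun c i => Cofan.IsColimit.fac (SheafOfModules.isColimitFreeCofan I) _ i
  -- the injective `End(𝒪)`-linear map `End(𝒪)^(I) → End(𝒪)^K`, `c ↦ (k ↦ ι_k ≫ π ≫ D c)`
  let Φ : (I →₀ End (SheafOfModules.unit (X.ringCatSheaf.over W))) →ₗ[
      End (SheafOfModules.unit (X.ringCatSheaf.over W))]
        (K → End (SheafOfModules.unit (X.ringCatSheaf.over W))) :=
    { toFun := fun c k => End.of (SheafOfModules.ιFree k ≫ π ≫ D c)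
      map_add' := fun c c' => by
        have e : D (c + c') = D c + D c' := free_hom_ext _ _ fun i => by
          rw [Preadditive.comp_add, hD, hD, hD, Finsupp.add_apply]; rfl
        funext k
        change End.of (SheafOfModules.ιFree k ≫ π ≫ D (c + c')) =
          End.of (SheafOfModules.ιFree k ≫ π ≫ D c) + End.of (SheafOfModules.ιFree k ≫ π ≫ D c')
        rw [e, Preadditive.comp_add, Preadditive.comp_add]
        rfl
      map_smul' := fun b c => by
        have e : D (b • c) = D c ≫ End.asHom b := free_hom_ext _ _ fun i => by
          rw [hD, ← Category.assoc, hD, Finsupp.smul_apply, smul_eq_mul]; rfl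
        funext k
        change SheafOfModules.ιFree k ≫ π ≫ D (b • c) = (SheafOfModules.ιFree k ≫ π ≫ D c) ≫ End.asHom b
        simp only [e, Category.assoc] }
  have hΦ : LinearMap.ker Φ = ⊥ := by
    refine LinearMap.ker_eq_bot'.mpr fun c hc => ?_
    have h1 : π ≫ D c = 0 := free_hom_ext _ _ fun k => by rw [comp_zero]; exact congrFun hc k
    have h2 : D c = 0 := by rw [← cancel_epi π, h1, comp_zero]
    ext i
    have h3 := hD c i
    rw [h2, comp_zero] at h3
    exact h3.symm
  -- the images of the basis vectors are linearly independent in `End(𝒪)^K`, `K` finite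
  have hli := (Finsupp.basisSingleOne.linearIndependent (R := End (SheafOfModules.unit
    (X.ringCatSheaf.over W))) (ι := I)).map' Φ hΦ
  exact hli.finite_of_le_span_finite _ (Set.range (Pi.basisFun _ K))
    (by rw [(Pi.basisFun _ K).span_eq]; exact le_top)

/-- For an affine-localizing module `M` trivialised, with a finite basis, over an open `U` containing
the basic open `D(g)` of an affine open `V`, there is a finitely generated submodule of `Γ(V, M)`
containing a `g`-power multiple of every section of `M` over `V` (numerators of the restricted basis
sections; the basis expansion over `D(g)`; torsion). -/
theorem exists_fg_pow_smul_mem {M : X.Modules} (hM : IsAffineLocalizing M)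
    {V : X.Opens} (hV : IsAffineOpen V) (g : Γ(X, V)) {U : X.Opens} (hgU : X.basicOpen g ≤ U)
    {I : Type u} [Fintype I] (e : SheafOfModules.free I ≅ M.over U) :
    ∃ N : Submodule Γ(X, V) Γ(M, V), N.FG ∧ ∀ m : Γ(M, V), ∃ n : ℕ, g ^ n • m ∈ N := by
  classical
  have hWV : X.basicOpen g ≤ V := X.basicOpen_le g
  -- the restricted basis sections and their numerators
  let b : I → Γ(M, X.basicOpen g) := fun i => M.presheaf.map (homOfLE hgU).op (basisSection e i)
  have hnum : ∀ i, ∃ (n : ℕ) (x : Γ(M, V)), M.presheaf.map (homOfLE hWV).op x =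
      X.presheaf.map (homOfLE hWV).op g ^ n • b i := fun i => hM.numerator hV g rfl (b i)
  choose n x hx using hnum
  let N : Submodule Γ(X, V) Γ(M, V) := Submodule.span Γ(X, V) (Set.range x)
  refine ⟨N, Submodule.fg_span (Set.finite_range x), fun m => ?_⟩
  -- every section over `D(g)` becomes, after a power of `g`, the restriction of an element of `N`
  have key : ∀ s : Γ(M, X.basicOpen g), ∃ (k : ℕ) (y : Γ(M, V)), y ∈ N ∧
      M.presheaf.map (homOfLE hWV).op y = X.presheaf.map (homOfLE hWV).op g ^ k • s := by
    intro s
    have hs : s ∈ Submodule.span Γ(X, X.basicOpen g) (Set.range b) := by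
      rw [eq_sum_coord_smul e (homOfLE hgU) s]
      exact Submodule.sum_mem _ fun i _ => Submodule.smul_mem _ _ (Submodule.subset_span ⟨i, rfl⟩)
    induction hs using Submodule.span_induction with
    | mem s hs =>
      obtain ⟨i, rfl⟩ := hs
      exact ⟨n i, x i, Submodule.subset_span ⟨i, rfl⟩, hx i⟩
    | zero => exact ⟨0, 0, N.zero_mem, by rw [map_zero, smul_zero]⟩
    | add s s' _ _ ih ih' =>
      obtain ⟨k, y, hy, hys⟩ := ih
      obtain ⟨k', y', hy', hys'⟩ := ih'
      refine ⟨k + k', g ^ k' • y + g ^ k • y', N.add_mem (N.smul_mem _ hy) (N.smul_mem _ hy'), ?_⟩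
      rw [map_add, Scheme.Modules.map_smul, Scheme.Modules.map_smul, hys, hys', map_pow, map_pow,
        smul_smul, smul_smul, ← pow_add, ← pow_add, add_comm k' k, smul_add]
    | smul c s _ ih =>
      obtain ⟨k, y, hy, hys⟩ := ih
      haveI := hV.isLocalization_basicOpen g
      obtain ⟨⟨a, ⟨_, k', rfl⟩⟩, hac⟩ := IsLocalization.surj (Submonoid.powers g) c
      refine ⟨k' + k, a • y, N.smul_mem a hy, ?_⟩
      change c * X.presheaf.map (homOfLE hWV).op (g ^ k') = X.presheaf.map (homOfLE hWV).op a at hac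
      rw [Scheme.Modules.map_smul, hys, ← hac, map_pow, smul_smul, smul_smul, pow_add]
      ring_nf
  obtain ⟨k, y, hy, hyk⟩ := key (M.presheaf.map (homOfLE hWV).op m)
  have h0 : M.presheaf.map (homOfLE hWV).op (y - g ^ k • m) = 0 := by
    rw [map_sub, Scheme.Modules.map_smul, map_pow, hyk, sub_self]
  obtain ⟨k', hk'⟩ := hM.torsion hV g (y - g ^ k • m) hWV le_rfl h0
  refine ⟨k' + k, ?_⟩
  rw [smul_sub, sub_eq_zero] at hk'
  rw [pow_add, mul_smul, ← hk']
  exact N.smul_mem _ hy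

/-- **An affine-localizing vector bundle is of affine-finite type**: `Γ(V, M)` is a finitely
generated `Γ(V, 𝒪_X)`-module for affine `V`. First `M` is FINITE locally free (Stacks 01C6: at `x`,
restrict a trivialisation `M|_U ≅ 𝒪^I` and finitely many generators of `M|_{U'}` to `W = U ∩ U' ∋ x` and
apply `finite_of_epi_free_over`; adapted from `isFiniteLocallyFree_of_isVectorBundle` of
`Theorems/FormalLiftingFromClassLifting/Negative/VectorBundleConverse.lean`); then cover `V` by basic
opens `D(g)` inside finite trivialising opens (`exists_fg_pow_smul_mem`) and descend finite generation
along the finite basic open cover (Mathlib `Submodule.mem_of_span_eq_top_of_smul_pow_mem`). -/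
theorem isAffineFiniteType_of_isVectorBundle {M : X.Modules} (hM : IsVectorBundle M)
    (hloc : IsAffineLocalizing M) : IsAffineFiniteType M := by
  classical
  -- `M` is finite locally free
  have hfree : IsFiniteLocallyFree M := by
    obtain ⟨q, hq⟩ := hM.1.exists_isLocallyFreeData
    haveI := hM.2
    obtain ⟨q', hq'⟩ := SheafOfModules.IsFiniteType.exists_localGeneratorsData M
    intro x
    obtain ⟨a, ha⟩ := ((Opens.coversTop_iff _ q.X).mp q.coversTop).exists_mem x
    obtain ⟨b, hb⟩ := ((Opens.coversTop_iff _ q'.X).mp q'.coversTop).exists_mem x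
    refine ⟨q.X a, ha, (q.generators a).I, ?_, ⟨asIso (q.generators a).π⟩⟩
    let W : X.Opens := q.X a ⊓ q'.X b
    haveI : Nonempty W := ⟨⟨x, ⟨ha, hb⟩⟩⟩
    haveI : (q'.generators b).IsFiniteType := hq'.isFiniteType b
    let eW : SheafOfModules.free (q.generators a).I ≅ M.over W :=
      SheafOfModules.restrictTrivialisation (R := X.ringCatSheaf) (homOfLE inf_le_left)
        (asIso (q.generators a).π)
    let g : W ⟶ q'.X b := homOfLE inf_le_right
    let πW : SheafOfModules.free (q'.generators b).I ⟶ M.over W :=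
      (SheafOfModules.mapFreeIso (SheafOfModules.overMap X.ringCatSheaf g) _
          (SheafOfModules.overMapUnitIso g).symm).hom ≫
        (SheafOfModules.overMap X.ringCatSheaf g).map (q'.generators b).π ≫
          ((SheafOfModules.overFunctorMap X.ringCatSheaf g).app M).hom
    haveI : Epi πW := by dsimp only [πW]; infer_instance
    exact finite_of_epi_free_over W (πW ≫ eW.inv)
  intro V hV
  -- the functions `g` on `V` with a fixed f.g. submodule containing a `g`-power multiple of everything
  let T : Set Γ(X, V) :=
    {g | ∃ N : Submodule Γ(X, V) Γ(M, V), N.FG ∧ ∀ m : Γ(M, V), ∃ n : ℕ, g ^ n • m ∈ N}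
  have hT : Ideal.span T = ⊤ := by
    rw [← hV.self_le_iSup_basicOpen_iff]
    intro x hxV
    obtain ⟨U, hxU, I, hI, ⟨e⟩⟩ := hfree x
    haveI := Fintype.ofFinite I
    obtain ⟨g, hgU, hxg⟩ := hV.exists_basicOpen_le ⟨x, hxU⟩ hxV
    have hgT : g ∈ T := exists_fg_pow_smul_mem hloc hV g hgU e
    exact Opens.mem_iSup.mpr ⟨⟨g, hgT⟩, hxg⟩
  obtain ⟨T', hT'T, hT'⟩ := (Ideal.span_eq_top_iff_finite T).mp hT
  have hT'' : ∀ g : T', ∃ N : Submodule Γ(X, V) Γ(M, V), N.FG ∧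
      ∀ m : Γ(M, V), ∃ n : ℕ, (g : Γ(X, V)) ^ n • m ∈ N := fun g => hT'T g.2
  choose N hNfg hN using hT''
  have hN₀ : (⨆ g, N g).FG := Submodule.fg_iSup N hNfg
  have htop : (⨆ g, N g) = ⊤ := by
    refine eq_top_iff.mpr fun m _ => ?_
    refine Submodule.mem_of_span_eq_top_of_smul_pow_mem _ (T' : Set Γ(X, V)) hT' m fun g => ?_
    obtain ⟨n, hn⟩ := hN ⟨g, g.2⟩ m
    exact ⟨n, le_iSup N _ hn⟩
  exact ⟨by rw [← htop]; exact hN₀⟩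

/-- **A vector bundle is coherent** in the affine-local sense `Coh` of the dévissage: quasi-coherent
(locally free) modules are affine-localizing (`IsAffineLocalizing.of_isQuasicoherent`), and then of
affine-finite type (`isAffineFiniteType_of_isVectorBundle`). -/
theorem coh_of_isVectorBundle {M : X.Modules} (hM : IsVectorBundle M) : Coh M := by
  haveI := hM.isLocallyFree
  have hloc : IsAffineLocalizing M := IsAffineLocalizing.of_isQuasicoherent M
  exact ⟨hloc, isAffineFiniteType_of_isVectorBundle hM hloc⟩

end Coh

/-! ## Čech bookkeeping -/

section Cech

variable {A : Type u} [CommRing A] {X : Scheme.{u}} (f : X ⟶ Spec (.of A)) {ι : Type u}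
  (U : ι → X.Opens)

/-- Multiplication by (the image of) `x ∈ A` acts on Čech `1`-cochains as the scalar `x`. -/
theorem cechMapC1_globalScalar (M : X.Modules) (x : A) (c : CechMC1 f M U) :
    cechMapC1 f (globalScalar M (algebraMapΓ f x)) U c = x • c := by
  funext i j
  rfl

/-- Multiplication by (the image of) `x ∈ A` acts on `Ȟ¹(𝒰, M)` as the scalar `x`. -/
theorem cechMapH1_globalScalar (M : X.Modules) (x : A) (y : CechMH1 f M U) :
    cechMapH1 f (globalScalar M (algebraMapΓ f x)) U y = x • y := by
  obtain ⟨z, rfl⟩ := CechMH1.mk_surjective f M U y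
  rw [cechMapH1_mk, ← map_smul]
  exact congrArg _ (Subtype.ext (cechMapC1_globalScalar f U M x z))

/-- `Ȟ⁰(𝒰, M) ≅ Γ(X, M)` is natural in `M`. -/
theorem cechMH0EquivSections_app (hU : ⨆ i, U i = ⊤) {M N : X.Modules} (φ : M ⟶ N)
    (m : MSections f M ⊤) :
    cechMH0EquivSections f U N hU (MSections.app f φ ⊤ m) =
      cechMapH0 f φ U (cechMH0EquivSections f U M hU m) :=
  Subtype.ext (funext fun i => MSections.res_app f φ (le_top : U i ≤ ⊤) m)

end Cech

/-- If `a` acts injectively on `M`, so do its powers. -/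
theorem mono_globalScalar_pow {X : Scheme.{u}} (M : X.Modules) {R : Type*} [CommRing R]
    (φ : R →+* Γ(X, ⊤)) (a : R) (h : Mono (globalScalar M (φ a))) (k : ℕ) :
    Mono (globalScalar M (φ (a ^ k))) := by
  induction k with
  | zero =>
    rw [pow_zero, map_one, globalScalar_one]
    infer_instance
  | succ k ih =>
    rw [pow_succ, map_mul, globalScalar_mul]
    exact mono_comp _ _

/-! ## The module Bockstein lemma -/

/-- **One-level `H⁰` formal functions for a vector bundle (module Bockstein lemma).** For `A`
Noetherian, `f : X → Spec A` proper, `a ∈ A` and a vector bundle `M` on `X` on which `a` is regular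
(`Mono (a · 𝟙_M)`), there is `c` such that for every `n` and every morphism `r : M/a^{n+1+c} → M/a^{n+1}`
under `M` (`M/a^m := cokernel (a^m · 𝟙_M)`), every global section `t` of `M/a^{n+1+c}` has `r t` equal
to the class of a global section of `M`: `c` is the exponent killing the `a`-power torsion of the
finite `A`-module `Ȟ¹(𝒰, M)` (dévissage), and the obstruction `δ_{n+1}(r t) = a^c δ_N(t)` vanishes since
`a^N δ_N(t) = 0`. -/
theorem stub_moduleBockstein :
    ∀ (A : Type) [CommRing A] [IsNoetherianRing A] (X : Scheme.{0}) (f : X ⟶ Spec (.of A))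
      [IsProper f] (a : A) (M : X.Modules), IsVectorBundle M →
      Mono (globalScalar M (algebraMapΓ f a)) →
      ∃ c : ℕ, ∀ (n : ℕ)
        (r : cokernel (globalScalar M (algebraMapΓ f (a ^ (n + 1 + c)))) ⟶
          cokernel (globalScalar M (algebraMapΓ f (a ^ (n + 1))))),
        cokernel.π (globalScalar M (algebraMapΓ f (a ^ (n + 1 + c)))) ≫ r =
          cokernel.π (globalScalar M (algebraMapΓ f (a ^ (n + 1)))) →
        ∀ t : Γ(cokernel (globalScalar M (algebraMapΓ f (a ^ (n + 1 + c)))), ⊤),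
          ∃ s : Γ(M, ⊤),
            (cokernel.π (globalScalar M (algebraMapΓ f (a ^ (n + 1))))).app ⊤ s = r.app ⊤ t := by
  intro A _ _ X f _ a M hM hmono
  classical
  -- a finite affine open cover of the compact, locally Noetherian `X`
  haveI : IsLocallyNoetherian X := LocallyOfFiniteType.isLocallyNoetherian f
  haveI : CompactSpace X := QuasiCompact.compactSpace_of_compactSpace f
  obtain ⟨T, hT⟩ := exists_finite_affineOpens_iSup_eq_top (X := X)
  let U : T → X.Opens := fun V => ((V : X.affineOpens) : X.Opens)
  have hU : ∀ i, IsAffineOpen (U i) := fun V => V.1.2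
  have hUcov : ⨆ i, U i = ⊤ := hT
  -- `Ȟ¹(𝒰, M)` is a finite `A`-module (dévissage), with `a`-power torsion killed by `a^c`
  have hcoh : Coh M := coh_of_isVectorBundle hM
  have hK : InK f U M := devissage (f := f) (U := U) hU (heart_holds f hU hUcov) M hcoh
  haveI := hK.finite_H1
  haveI : IsNoetherian A (CechMH1 f M U) := isNoetherian_of_isNoetherianRing_of_finite A _
  obtain ⟨c, hc⟩ := InfinitesimalCech.exists_torsionBy_pow_stable (H := CechMH1 f M U) a
  refine ⟨c, fun n r hr t => ?_⟩
  -- the Čech exactness data of `0 → M —a^k→ M → M/a^k → 0` on the affine cover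
  have hD : ∀ k : ℕ, CechExactData f U (globalScalar M (algebraMapΓ f (a ^ k)))
      (cokernel.π (globalScalar M (algebraMapΓ f (a ^ k)))) := fun k =>
    haveI := mono_globalScalar_pow M (algebraMapΓ f) a hmono k
    CechExactData.of_shortExact f U (S := ShortComplex.mk (globalScalar M (algebraMapΓ f (a ^ k)))
      (cokernel.π _) (cokernel.condition _))
      (ShortComplex.ShortExact.mk' (ShortComplex.exact_cokernel _) inferInstance inferInstance)
      hcoh.loc hU
  -- `t` as a Čech `0`-cocycle; its obstruction class `δ_N t`, `N = n + 1 + c`, is killed by `a^N`,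
  -- hence by `a^c`
  obtain ⟨t'', ht''⟩ : ∃ t'' : cechMH0 f (cokernel (globalScalar M (algebraMapΓ f (a ^ (n + 1 + c))))) U,
      t'' = cechMH0EquivSections f U _ hUcov (t : MSections f _ ⊤) := ⟨_, rfl⟩
  have hkill : a ^ (n + 1 + c) • (hD (n + 1 + c)).cechDelta t'' = 0 := by
    have h := (hD (n + 1 + c)).cechMapH1_cechDelta t''
    rwa [cechMapH1_globalScalar] at h
  have hkill' : a ^ c • (hD (n + 1 + c)).cechDelta t'' = 0 := hc (n + 1 + c) (by omega) _ hkill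
  -- naturality along the morphism of sequences `(a^c, 𝟙, r)`: `δ_{n+1} (r t) = a^c • δ_N t = 0`
  have hnat : (hD (n + 1)).cechDelta (cechMapH0 f r U t'') =
      a ^ c • (hD (n + 1 + c)).cechDelta t'' := by
    have hb : cechMapC0 f (cokernel.π (globalScalar M (algebraMapΓ f (a ^ (n + 1))))) U
        ((hD (n + 1 + c)).lift t'') = (cechMapH0 f r U t'' : CechMC0 f _ U) := by
      rw [cechMapH0_coe, ← hr]
      change cechMapC0 f r U (cechMapC0 f
        (cokernel.π (globalScalar M (algebraMapΓ f (a ^ (n + 1 + c))))) U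
          ((hD (n + 1 + c)).lift t'')) = _
      rw [(hD (n + 1 + c)).app_lift]
    have hc' : cechMapC1 f (globalScalar M (algebraMapΓ f (a ^ (n + 1)))) U
        (a ^ c • (hD (n + 1 + c)).deltaCocycle t'') = cechMD0 f M U ((hD (n + 1 + c)).lift t'') := by
      rw [cechMapC1_globalScalar, smul_smul, ← pow_add, ← (hD (n + 1 + c)).app_deltaCocycle t'',
        cechMapC1_globalScalar]
    rw [(hD (n + 1)).cechDelta_spec (cechMapH0 f r U t'') ((hD (n + 1 + c)).lift t'') hb _ hc']
    change _ = a ^ c • CechMH1.mk f M U ⟨(hD (n + 1 + c)).deltaCocycle t'',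
      (hD (n + 1 + c)).mem_cechMZ1_of_app_eq_cechMD0 ((hD (n + 1 + c)).app_deltaCocycle t'')⟩
    rw [← map_smul]
    rfl
  rw [hkill'] at hnat
  -- hence `r t` lifts to a Čech `0`-cocycle of `M`, i.e. to a global section of `M`
  obtain ⟨b, hb⟩ := (hD (n + 1)).exists_cechMapH0_eq_of_cechDelta_eq_zero _ hnat
  refine ⟨(cechMH0EquivSections f U M hUcov).symm b, ?_⟩
  have key : cechMH0EquivSections f U _ hUcov
      (MSections.app f (cokernel.π (globalScalar M (algebraMapΓ f (a ^ (n + 1))))) ⊤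
        ((cechMH0EquivSections f U M hUcov).symm b)) =
      cechMH0EquivSections f U _ hUcov (MSections.app f r ⊤ (t : MSections f _ ⊤)) := by
    rw [cechMH0EquivSections_app, cechMH0EquivSections_app, LinearEquiv.apply_symm_apply, hb, ht'']
  exact (cechMH0EquivSections f U _ hUcov).injective key

end Summit.HodgeConjecture.HodgeConjecture.Theorems.FormalVectorBundlesAlgebraize

end
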